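import Summits.ValiantsHypothesis.ValiantsHypothesis.Theorems.PolyaContinuedSignedCoverLittleEarC
import HarnessLib

/-!
# Route PolyaContinued — support item `SignedCoverLittle` (stmt-ValiantsHypothesis-7426):
# ear lemma, part D — single-ear circuits, the fork injection, and the Case-B structure

Continues `…EarC.lean` (forks, parity of forks, cyclic order, spliceability of consecutive
forks). This file finishes step (EAR) of the paper proof `proof-LabelTransfer.md` (§2) for two
cyclic permutations `μ, ν` of a finite type ("dicircuits" `γ₊, γ₋`):

* `exists_ear` — the **single-ear circuit** at consecutive forks `p, p'`: a cyclic permutation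
  following `μ` from `p` to `p'` and `ν` from `p'` back to `p`, fixing everything else; it leaves `p`
  along `μ` (`ear_apply_fst`), `p'` along `ν` (`ear_apply_snd`), no other fork along `μ`
  (`ear_apply_ne`), moves every point as `μ`, as `ν` or not at all (`ear_apply_or`), and is
  neither `μ` nor `ν` (`ear_ne`);
* `card_forks_add_two_le` — **fork injection**: if every cyclic permutation moving each point as
  `μ`, as `ν`, or not at all lies in a finset `S ∋ μ, ν`, and there are at least two forks, then
  `#forks μ ν + 2 ≤ #S` (in the paper proof: `m + 2 ≤ 5`);
* `ear_caseB` — **Case B**: if moreover `#S ≤ 5`, any two members of `S` differ by a single cycle,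
  and there are `≥ 3` forks, then there are exactly three forks `p₀ → p₁ → p₂` (in `μ`-order),
  which `ν` meets in the OPPOSITE cyclic order `p₀ → p₂ → p₁`, and the three single-ear circuits
  `Z₀, Z₁, Z₂` follow `μ` on the `μ`-arcs `[p₀,p₁), [p₁,p₂), [p₂,p₀)` — a partition of `supp μ` —
  and `ν` on the `ν`-arcs `[p₁,p₀), [p₂,p₁), [p₀,p₂)` — a partition of `supp ν`. Case A (same
  cyclic order) is excluded by the parity lemma `odd_card_forks` applied to `μ` and `Z₀`, whose
  forks would be `{p₁, p₂}`. From this structure step (EVEN) reads off that the five circuits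
  `μ, ν, Z₀, Z₁, Z₂` cover every off-diagonal cell an even number of times.

In the application `μ, ν` are the lifts of the two long dicircuits of the Little obstruction, `S`
is the set of the five non-identity perfect matchings of `H₁` in normal form (every cyclic
permutation inside `H₁ ⊇ diagonal` is one of them), and any two perfect matchings of `H₁` differ
by a single alternating circuit (`isCycle_inv_mul_of_labelIdentity`).
-/

namespace Summit.ValiantsHypothesis.PolyaContinued

open Equiv Equiv.Perm Finset

variable {α : Type*} [Fintype α] [DecidableEq α]

/-! ### Single-ear circuits -/

/-- **The single-ear circuit.** For consecutive forks `p, p'` (no fork strictly between them along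
`μ`) there is a cyclic permutation following `μ` from `p` to `p'` and `ν` from `p'` back to `p`,
fixing everything else, with support the union of the two paths (the splice
`exists_splice_cycle` of `…EarB.lean`). [folklore] -/
theorem exists_ear {μ ν : Perm α} (hμ : μ.IsCycle) (hν : ν.IsCycle) {p p' : α}
    (hp : p ∈ forks μ ν) (hp' : p' ∈ forks μ ν) (hpp' : p ≠ p')
    (hno : ∀ x ∈ forks μ ν, x ∈ pathSet μ p p' → x = p) :
    ∃ W : Perm α, W.IsCycle ∧ (∀ v ∈ pathSet μ p p', W v = μ v) ∧
      (∀ v ∈ pathSet ν p' p, W v = ν v) ∧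
      (∀ v, v ∉ pathSet μ p p' → v ∉ pathSet ν p' p → W v = v) ∧
      W.support = pathSet μ p p' ∪ pathSet ν p' p :=
  exists_splice_cycle hμ hν (mem_support_of_mem_forks_left hp) (mem_support_of_mem_forks_left hp')
    (mem_support_of_mem_forks_right hp) (mem_support_of_mem_forks_right hp') hpp'
    (disjoint_pathSet_of_forks hμ hν hp hp' hno)

/-- A single-ear circuit moves every point as `μ` does, as `ν` does, or not at all. [folklore] -/
theorem ear_apply_or {μ ν W : Perm α} {p p' : α}
    (h1 : ∀ v ∈ pathSet μ p p', W v = μ v) (h2 : ∀ v ∈ pathSet ν p' p, W v = ν v)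
    (h3 : ∀ v, v ∉ pathSet μ p p' → v ∉ pathSet ν p' p → W v = v) (v : α) :
    W v = μ v ∨ W v = ν v ∨ W v = v := by
  by_cases hv1 : v ∈ pathSet μ p p'
  · exact Or.inl (h1 v hv1)
  by_cases hv2 : v ∈ pathSet ν p' p
  · exact Or.inr (Or.inl (h2 v hv2))
  · exact Or.inr (Or.inr (h3 v hv1 hv2))

/-- A single-ear circuit leaves its first fork along `μ`. [folklore] -/
theorem ear_apply_fst {μ ν W : Perm α} (hμ : μ.IsCycle) {p p' : α} (hp : p ∈ forks μ ν)
    (hp' : p' ∈ forks μ ν) (hpp' : p ≠ p') (h1 : ∀ v ∈ pathSet μ p p', W v = μ v) :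
    W p = μ p :=
  h1 p ((start_mem_pathSet_iff hμ (mem_support_of_mem_forks_left hp)
    (mem_support_of_mem_forks_left hp')).2 hpp')

/-- A single-ear circuit leaves its second fork along `ν`. [folklore] -/
theorem ear_apply_snd {μ ν W : Perm α} (hν : ν.IsCycle) {p p' : α} (hp : p ∈ forks μ ν)
    (hp' : p' ∈ forks μ ν) (hpp' : p ≠ p') (h2 : ∀ v ∈ pathSet ν p' p, W v = ν v) :
    W p' = ν p' :=
  h2 p' ((start_mem_pathSet_iff hν (mem_support_of_mem_forks_right hp')
    (mem_support_of_mem_forks_right hp)).2 hpp'.symm)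

/-- At any fork `r` other than its first fork, a single-ear circuit does NOT follow `μ` (it follows
`ν` or stays put; no fork lies strictly inside the `μ`-path from `p` to `p'`). [folklore] -/
theorem ear_apply_ne {μ ν W : Perm α} {p p' r : α}
    (hno : ∀ x ∈ forks μ ν, x ∈ pathSet μ p p' → x = p)
    (h2 : ∀ v ∈ pathSet ν p' p, W v = ν v)
    (h3 : ∀ v, v ∉ pathSet μ p p' → v ∉ pathSet ν p' p → W v = v)
    (hr : r ∈ forks μ ν) (hrp : r ≠ p) : W r ≠ μ r := by
  obtain ⟨hμr, -, hμν⟩ := mem_forks.1 hr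
  have hr1 : r ∉ pathSet μ p p' := fun h => hrp (hno r hr h)
  by_cases hr2 : r ∈ pathSet ν p' p
  · rw [h2 r hr2]; exact Ne.symm hμν
  · rw [h3 r hr1 hr2]; exact Ne.symm hμr

/-- A single-ear circuit is neither `μ` nor `ν` (given a second fork). [folklore] -/
theorem ear_ne {μ ν W : Perm α} (hμ : μ.IsCycle) {p p' : α} (hp : p ∈ forks μ ν)
    (hp' : p' ∈ forks μ ν) (hpp' : p ≠ p')
    (hno : ∀ x ∈ forks μ ν, x ∈ pathSet μ p p' → x = p)
    (h1 : ∀ v ∈ pathSet μ p p', W v = μ v) (h2 : ∀ v ∈ pathSet ν p' p, W v = ν v)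
    (h3 : ∀ v, v ∉ pathSet μ p p' → v ∉ pathSet ν p' p → W v = v) : W ≠ μ ∧ W ≠ ν := by
  constructor
  · intro hW
    exact ear_apply_ne hno h2 h3 hp' hpp'.symm (by rw [hW])
  · intro hW
    have := ear_apply_fst hμ hp hp' hpp' h1
    rw [hW] at this
    exact (mem_forks.1 hp).2.2 this.symm

/-- **The next fork.** With at least two forks, every fork `p` has a next fork `p'` along `μ`: no
fork lies strictly inside the `μ`-path from `p` to `p'`. [folklore] -/
theorem exists_next_fork {μ ν : Perm α} {p : α} (hp : p ∈ forks μ ν)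
    (h2 : 2 ≤ (forks μ ν).card) :
    ∃ p' ∈ forks μ ν, p ≠ p' ∧ ∀ x ∈ forks μ ν, x ∈ pathSet μ p p' → x = p := by
  have hne : ((forks μ ν).erase p).Nonempty := by
    rw [← Finset.card_pos, Finset.card_erase_of_mem hp]; omega
  obtain ⟨p', hp'm, hmin⟩ :=
    Finset.exists_min_image ((forks μ ν).erase p) (fun x => cdist μ p x) hne
  refine ⟨p', Finset.mem_of_mem_erase hp'm, (Finset.ne_of_mem_erase hp'm).symm,
    fun x hx hxp => ?_⟩
  by_contra hxp'
  have := hmin x (Finset.mem_erase.2 ⟨hxp', hx⟩)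
  exact absurd (mem_pathSet.1 hxp).2 (not_lt.2 this)

/-- **Fork injection.** Let `μ, ν` be cyclic and let `S ∋ μ, ν` be a finset containing every
cyclic permutation that moves each point as `μ`, as `ν`, or not at all. If there are at least two
forks, then `#forks μ ν + 2 ≤ #S`: the single-ear circuits at the forks are members of `S`, pairwise
distinct (the one at `p` is the only one leaving `p` along `μ`), and distinct from `μ` and `ν`.
(In the paper proof: `m + 2 ≤ 5`.) [folklore] -/
theorem card_forks_add_two_le {μ ν : Perm α} (hμ : μ.IsCycle) (hν : ν.IsCycle)
    (S : Finset (Perm α)) (hμS : μ ∈ S) (hνS : ν ∈ S)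
    (hS : ∀ c : Perm α, c.IsCycle → (∀ v, c v = μ v ∨ c v = ν v ∨ c v = v) → c ∈ S)
    (h2 : 2 ≤ (forks μ ν).card) : (forks μ ν).card + 2 ≤ S.card := by
  classical
  obtain ⟨p₀, hp₀⟩ : (forks μ ν).Nonempty := by rw [← Finset.card_pos]; omega
  have hμν : μ ≠ ν := ne_of_mem_forks hp₀
  have key : ∀ p ∈ forks μ ν, ∃ W : Perm α, W ∈ (S.erase μ).erase ν ∧ W p = μ p ∧
      ∀ r ∈ forks μ ν, r ≠ p → W r ≠ μ r := by
    intro p hp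
    obtain ⟨p', hp', hpp', hno⟩ := exists_next_fork hp h2
    obtain ⟨W, hW, h1, h2', h3, -⟩ := exists_ear hμ hν hp hp' hpp' hno
    obtain ⟨hWμ, hWν⟩ := ear_ne hμ hp hp' hpp' hno h1 h2' h3
    exact ⟨W, Finset.mem_erase.2 ⟨hWν, Finset.mem_erase.2 ⟨hWμ, hS W hW (ear_apply_or h1 h2' h3)⟩⟩,
      ear_apply_fst hμ hp hp' hpp' h1, fun r hr hrp => ear_apply_ne hno h2' h3 hr hrp⟩
  choose! f hf using key
  have hinj : Set.InjOn f (forks μ ν) := by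
    intro p hp p' hp' hfe
    by_contra hne
    have h1 := (hf p hp).2.1
    rw [hfe] at h1
    exact (hf p' hp').2.2 p hp hne h1
  have hle := Finset.card_le_card_of_injOn f (fun p hp => (hf p hp).1) hinj
  rw [Finset.card_erase_of_mem (Finset.mem_erase.2 ⟨hμν.symm, hνS⟩),
    Finset.card_erase_of_mem hμS] at hle
  have := Finset.card_pos.2 ⟨μ, hμS⟩
  omega

/-! ### Case B -/

/-- The forks of `μ` and a single-ear circuit `W` (ear from `p` to `p'`) are the forks of `μ, ν`
lying on the `ν`-path from `p'` to `p`. [folklore] -/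
theorem mem_forks_ear_iff {μ ν W : Perm α} {p p' x : α}
    (h1 : ∀ v ∈ pathSet μ p p', W v = μ v) (h2 : ∀ v ∈ pathSet ν p' p, W v = ν v)
    (h4 : W.support = pathSet μ p p' ∪ pathSet ν p' p) :
    x ∈ forks μ W ↔ x ∈ forks μ ν ∧ x ∈ pathSet ν p' p := by
  rw [mem_forks, mem_forks]
  constructor
  · rintro ⟨hμx, hWx, hne⟩
    have hx : x ∈ W.support := mem_support.2 hWx
    rw [h4, mem_union] at hx
    rcases hx with hx | hx
    · exact absurd (h1 x hx).symm hne
    · have hWν := h2 x hx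
      refine ⟨⟨hμx, ?_, ?_⟩, hx⟩
      · rw [← hWν]; exact hWx
      · rw [← hWν]; exact hne
  · rintro ⟨⟨hμx, hνx, hne⟩, hx⟩
    have hWν := h2 x hx
    exact ⟨hμx, by rw [hWν]; exact hνx, by rw [hWν]; exact hne⟩

/-- Case B, ordered version: the three forks are given in `μ`-order. [folklore] -/
theorem ear_caseB_of_order {μ ν : Perm α} (hμ : μ.IsCycle) (hν : ν.IsCycle)
    (S : Finset (Perm α)) (hμS : μ ∈ S)
    (hS : ∀ c : Perm α, c.IsCycle → (∀ v, c v = μ v ∨ c v = ν v ∨ c v = v) → c ∈ S)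
    (hcyc : ∀ c ∈ S, ∀ c' ∈ S, c ≠ c' → (c⁻¹ * c').IsCycle)
    {p₀ p₁ p₂ : α} (hF : forks μ ν = {p₀, p₁, p₂}) (h01 : p₀ ≠ p₁) (h12 : p₁ ≠ p₂)
    (h02 : p₀ ≠ p₂) (hord : p₁ ∈ pathSet μ p₀ p₂) :
    ∃ Z₀ Z₁ Z₂ : Perm α,
      p₂ ∈ pathSet ν p₀ p₁ ∧
      (Z₀.IsCycle ∧ Z₀ ∈ S ∧ Z₀ ≠ μ ∧ Z₀ ≠ ν ∧ (∀ v ∈ pathSet μ p₀ p₁, Z₀ v = μ v) ∧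
        (∀ v ∈ pathSet ν p₁ p₀, Z₀ v = ν v) ∧
        (∀ v, v ∉ pathSet μ p₀ p₁ → v ∉ pathSet ν p₁ p₀ → Z₀ v = v) ∧
        Z₀.support = pathSet μ p₀ p₁ ∪ pathSet ν p₁ p₀) ∧
      (Z₁.IsCycle ∧ Z₁ ∈ S ∧ Z₁ ≠ μ ∧ Z₁ ≠ ν ∧ (∀ v ∈ pathSet μ p₁ p₂, Z₁ v = μ v) ∧
        (∀ v ∈ pathSet ν p₂ p₁, Z₁ v = ν v) ∧
        (∀ v, v ∉ pathSet μ p₁ p₂ → v ∉ pathSet ν p₂ p₁ → Z₁ v = v) ∧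
        Z₁.support = pathSet μ p₁ p₂ ∪ pathSet ν p₂ p₁) ∧
      (Z₂.IsCycle ∧ Z₂ ∈ S ∧ Z₂ ≠ μ ∧ Z₂ ≠ ν ∧ (∀ v ∈ pathSet μ p₂ p₀, Z₂ v = μ v) ∧
        (∀ v ∈ pathSet ν p₀ p₂, Z₂ v = ν v) ∧
        (∀ v, v ∉ pathSet μ p₂ p₀ → v ∉ pathSet ν p₀ p₂ → Z₂ v = v) ∧
        Z₂.support = pathSet μ p₂ p₀ ∪ pathSet ν p₀ p₂) ∧
      (Z₀ ≠ Z₁ ∧ Z₁ ≠ Z₂ ∧ Z₂ ≠ Z₀) ∧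
      ((∀ v ∈ μ.support, v ∈ pathSet μ p₀ p₁ ∨ v ∈ pathSet μ p₁ p₂ ∨ v ∈ pathSet μ p₂ p₀) ∧
        Disjoint (pathSet μ p₀ p₁) (pathSet μ p₁ p₂) ∧
        Disjoint (pathSet μ p₁ p₂) (pathSet μ p₂ p₀) ∧
        Disjoint (pathSet μ p₂ p₀) (pathSet μ p₀ p₁)) ∧
      ((∀ v ∈ ν.support, v ∈ pathSet ν p₁ p₀ ∨ v ∈ pathSet ν p₂ p₁ ∨ v ∈ pathSet ν p₀ p₂) ∧
        Disjoint (pathSet ν p₁ p₀) (pathSet ν p₂ p₁) ∧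
        Disjoint (pathSet ν p₂ p₁) (pathSet ν p₀ p₂) ∧
        Disjoint (pathSet ν p₀ p₂) (pathSet ν p₁ p₀)) := by
  classical
  have hp₀ : p₀ ∈ forks μ ν := by rw [hF]; simp
  have hp₁ : p₁ ∈ forks μ ν := by rw [hF]; simp
  have hp₂ : p₂ ∈ forks μ ν := by rw [hF]; simp
  have hp₀μ := mem_support_of_mem_forks_left hp₀
  have hp₁μ := mem_support_of_mem_forks_left hp₁
  have hp₂μ := mem_support_of_mem_forks_left hp₂
  have hp₀ν := mem_support_of_mem_forks_right hp₀
  have hp₁ν := mem_support_of_mem_forks_right hp₁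
  have hp₂ν := mem_support_of_mem_forks_right hp₂
  have hmemF : ∀ x ∈ forks μ ν, x = p₀ ∨ x = p₁ ∨ x = p₂ := by
    intro x hx; rw [hF] at hx; simpa using hx
  have hordlt := (mem_pathSet.1 hord).2
  -- no fork strictly inside the three `μ`-arcs
  have hno₀ : ∀ x ∈ forks μ ν, x ∈ pathSet μ p₀ p₁ → x = p₀ := by
    intro x hx hxm
    rcases hmemF x hx with rfl | rfl | rfl
    · rfl
    · exact absurd hxm (notMem_pathSet_end μ p₀ x)
    · have := (mem_pathSet.1 hxm).2; omega
  have hno₁ : ∀ x ∈ forks μ ν, x ∈ pathSet μ p₁ p₂ → x = p₁ := by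
    intro x hx hxm
    rcases hmemF x hx with rfl | rfl | rfl
    · have := (mem_pathSet_iff_le_and_lt hμ hp₀μ hp₁μ hp₂μ hp₀μ hord).1 hxm
      rw [cdist_self] at this
      have h0 : cdist μ x p₁ = 0 := by omega
      exact absurd ((cdist_eq_zero_iff hμ hp₀μ hp₁μ).1 h0) h01.symm
    · rfl
    · exact absurd hxm (notMem_pathSet_end μ p₁ x)
  have hno₂ : ∀ x ∈ forks μ ν, x ∈ pathSet μ p₂ p₀ → x = p₂ := by
    intro x hx hxm
    rcases hmemF x hx with rfl | rfl | rfl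
    · exact absurd hxm (notMem_pathSet_end μ p₂ x)
    · have := (mem_pathSet_iff_le hμ hp₀μ hp₂μ hp₁μ h02).1 hxm; omega
    · rfl
  -- the three single-ear circuits
  obtain ⟨Z₀, hZ₀c, h0₁, h0₂, h0₃, h0₄⟩ := exists_ear hμ hν hp₀ hp₁ h01 hno₀
  obtain ⟨Z₁, hZ₁c, h1₁, h1₂, h1₃, h1₄⟩ := exists_ear hμ hν hp₁ hp₂ h12 hno₁
  obtain ⟨Z₂, hZ₂c, h2₁, h2₂, h2₃, h2₄⟩ := exists_ear hμ hν hp₂ hp₀ h02.symm hno₂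
  have hZ₀S : Z₀ ∈ S := hS Z₀ hZ₀c (ear_apply_or h0₁ h0₂ h0₃)
  have hZ₁S : Z₁ ∈ S := hS Z₁ hZ₁c (ear_apply_or h1₁ h1₂ h1₃)
  have hZ₂S : Z₂ ∈ S := hS Z₂ hZ₂c (ear_apply_or h2₁ h2₂ h2₃)
  obtain ⟨hZ₀μ, hZ₀ν⟩ := ear_ne hμ hp₀ hp₁ h01 hno₀ h0₁ h0₂ h0₃
  obtain ⟨hZ₁μ, hZ₁ν⟩ := ear_ne hμ hp₁ hp₂ h12 hno₁ h1₁ h1₂ h1₃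
  obtain ⟨hZ₂μ, hZ₂ν⟩ := ear_ne hμ hp₂ hp₀ h02.symm hno₂ h2₁ h2₂ h2₃
  -- pairwise distinct: `Z_j` is the only one leaving `p_j` along `μ`
  have hZ₀₁ : Z₀ ≠ Z₁ := by
    intro h
    have e := ear_apply_fst hμ hp₀ hp₁ h01 h0₁
    rw [h] at e
    exact ear_apply_ne hno₁ h1₂ h1₃ hp₀ h01 e
  have hZ₁₂ : Z₁ ≠ Z₂ := by
    intro h
    have e := ear_apply_fst hμ hp₁ hp₂ h12 h1₁
    rw [h] at e
    exact ear_apply_ne hno₂ h2₂ h2₃ hp₁ h12 e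
  have hZ₂₀ : Z₂ ≠ Z₀ := by
    intro h
    have e := ear_apply_fst hμ hp₂ hp₀ h02.symm h2₁
    rw [h] at e
    exact ear_apply_ne hno₀ h0₂ h0₃ hp₂ h02.symm e
  -- Case A is excluded by parity: `p₂` is not on the `ν`-path from `p₁` to `p₀`
  have hodd : Odd (forks μ Z₀).card :=
    odd_card_forks hμ hZ₀c (hcyc μ hμS Z₀ hZ₀S (Ne.symm hZ₀μ))
  have hp₂ν₁₀ : p₂ ∉ pathSet ν p₁ p₀ := by
    intro hmem
    have hF' : forks μ Z₀ = {p₁, p₂} := by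
      ext x
      rw [mem_forks_ear_iff h0₁ h0₂ h0₄, Finset.mem_insert, Finset.mem_singleton]
      constructor
      · rintro ⟨hx, hxm⟩
        rcases hmemF x hx with rfl | rfl | rfl
        · exact absurd hxm (notMem_pathSet_end ν p₁ x)
        · exact Or.inl rfl
        · exact Or.inr rfl
      · rintro (rfl | rfl)
        · exact ⟨hp₁, (start_mem_pathSet_iff hν hp₁ν hp₀ν).2 h01.symm⟩
        · exact ⟨hp₂, hmem⟩
    rw [hF', Finset.card_pair h12] at hodd
    exact absurd hodd (by decide)
  have hν102 : p₀ ∈ pathSet ν p₁ p₂ :=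
    (mem_pathSet_iff_notMem_pathSet hν hp₁ν hp₀ν hp₂ν h02).2 hp₂ν₁₀
  have hνord : p₂ ∈ pathSet ν p₀ p₁ := mem_pathSet_rotate hν hp₁ν hp₀ν hp₂ν h01.symm hν102
  refine ⟨Z₀, Z₁, Z₂, hνord, ⟨hZ₀c, hZ₀S, hZ₀μ, hZ₀ν, h0₁, h0₂, h0₃, h0₄⟩,
    ⟨hZ₁c, hZ₁S, hZ₁μ, hZ₁ν, h1₁, h1₂, h1₃, h1₄⟩, ⟨hZ₂c, hZ₂S, hZ₂μ, hZ₂ν, h2₁, h2₂, h2₃, h2₄⟩,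
    ⟨hZ₀₁, hZ₁₂, hZ₂₀⟩, ⟨fun v hv => mem_pathSet_or_of_mem_support hμ hp₀μ hp₁μ hp₂μ hv hord,
      disjoint_pathSet_fst_snd hμ hp₀μ hp₁μ hp₂μ hord, disjoint_pathSet_snd_thd hμ hp₀μ hp₁μ hp₂μ hord,
      disjoint_pathSet_thd_fst hμ hp₀μ hp₂μ hord⟩, ⟨fun v hv => ?_, ?_, ?_, ?_⟩⟩
  · -- `ν`-arcs of the cyclic triple `p₀ → p₂ → p₁`
    rcases mem_pathSet_or_of_mem_support hν hp₀ν hp₂ν hp₁ν hv hνord with h | h | h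
    · exact Or.inr (Or.inr h)
    · exact Or.inr (Or.inl h)
    · exact Or.inl h
  · exact (disjoint_pathSet_snd_thd hν hp₀ν hp₂ν hp₁ν hνord).symm
  · exact (disjoint_pathSet_fst_snd hν hp₀ν hp₂ν hp₁ν hνord).symm
  · exact (disjoint_pathSet_thd_fst hν hp₀ν hp₁ν hνord).symm

/-- **Case B.** Let `μ, ν` be cyclic permutations with at least three forks, and let `S ∋ μ, ν`,
`#S ≤ 5`, contain every cyclic permutation moving each point as `μ`, as `ν`, or not at all, any two
members of `S` differing by a single cycle. Then there are exactly three forks `p₀, p₁, p₂`, in this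
cyclic order along `μ` and in the opposite cyclic order `p₀, p₂, p₁` along `ν`; the three
single-ear circuits `Z₀, Z₁, Z₂` (members of `S`, cyclic, pairwise distinct, distinct from `μ, ν`)
follow `μ` on the arcs `[p₀,p₁), [p₁,p₂), [p₂,p₀)`, which partition `supp μ`, and `ν` on the arcs
`[p₁,p₀), [p₂,p₁), [p₀,p₂)`, which partition `supp ν`, and fix all other points. (Step (EAR) of the
paper proof: `m = 3`, Case A excluded, Case B orders.) [folklore] -/
theorem ear_caseB {μ ν : Perm α} (hμ : μ.IsCycle) (hν : ν.IsCycle)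
    (S : Finset (Perm α)) (hS5 : S.card ≤ 5) (hμS : μ ∈ S) (hνS : ν ∈ S)
    (hS : ∀ c : Perm α, c.IsCycle → (∀ v, c v = μ v ∨ c v = ν v ∨ c v = v) → c ∈ S)
    (hcyc : ∀ c ∈ S, ∀ c' ∈ S, c ≠ c' → (c⁻¹ * c').IsCycle)
    (h3 : 3 ≤ (forks μ ν).card) :
    ∃ (p₀ p₁ p₂ : α) (Z₀ Z₁ Z₂ : Perm α),
      (forks μ ν = {p₀, p₁, p₂} ∧ p₀ ≠ p₁ ∧ p₁ ≠ p₂ ∧ p₀ ≠ p₂) ∧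
      (p₁ ∈ pathSet μ p₀ p₂ ∧ p₂ ∈ pathSet ν p₀ p₁) ∧
      (Z₀.IsCycle ∧ Z₀ ∈ S ∧ Z₀ ≠ μ ∧ Z₀ ≠ ν ∧ (∀ v ∈ pathSet μ p₀ p₁, Z₀ v = μ v) ∧
        (∀ v ∈ pathSet ν p₁ p₀, Z₀ v = ν v) ∧
        (∀ v, v ∉ pathSet μ p₀ p₁ → v ∉ pathSet ν p₁ p₀ → Z₀ v = v) ∧
        Z₀.support = pathSet μ p₀ p₁ ∪ pathSet ν p₁ p₀) ∧
      (Z₁.IsCycle ∧ Z₁ ∈ S ∧ Z₁ ≠ μ ∧ Z₁ ≠ ν ∧ (∀ v ∈ pathSet μ p₁ p₂, Z₁ v = μ v) ∧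
        (∀ v ∈ pathSet ν p₂ p₁, Z₁ v = ν v) ∧
        (∀ v, v ∉ pathSet μ p₁ p₂ → v ∉ pathSet ν p₂ p₁ → Z₁ v = v) ∧
        Z₁.support = pathSet μ p₁ p₂ ∪ pathSet ν p₂ p₁) ∧
      (Z₂.IsCycle ∧ Z₂ ∈ S ∧ Z₂ ≠ μ ∧ Z₂ ≠ ν ∧ (∀ v ∈ pathSet μ p₂ p₀, Z₂ v = μ v) ∧
        (∀ v ∈ pathSet ν p₀ p₂, Z₂ v = ν v) ∧
        (∀ v, v ∉ pathSet μ p₂ p₀ → v ∉ pathSet ν p₀ p₂ → Z₂ v = v) ∧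
        Z₂.support = pathSet μ p₂ p₀ ∪ pathSet ν p₀ p₂) ∧
      (Z₀ ≠ Z₁ ∧ Z₁ ≠ Z₂ ∧ Z₂ ≠ Z₀) ∧
      ((∀ v ∈ μ.support, v ∈ pathSet μ p₀ p₁ ∨ v ∈ pathSet μ p₁ p₂ ∨ v ∈ pathSet μ p₂ p₀) ∧
        Disjoint (pathSet μ p₀ p₁) (pathSet μ p₁ p₂) ∧
        Disjoint (pathSet μ p₁ p₂) (pathSet μ p₂ p₀) ∧
        Disjoint (pathSet μ p₂ p₀) (pathSet μ p₀ p₁)) ∧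
      ((∀ v ∈ ν.support, v ∈ pathSet ν p₁ p₀ ∨ v ∈ pathSet ν p₂ p₁ ∨ v ∈ pathSet ν p₀ p₂) ∧
        Disjoint (pathSet ν p₁ p₀) (pathSet ν p₂ p₁) ∧
        Disjoint (pathSet ν p₂ p₁) (pathSet ν p₀ p₂) ∧
        Disjoint (pathSet ν p₀ p₂) (pathSet ν p₁ p₀)) := by
  classical
  -- exactly three forks
  have hle := card_forks_add_two_le hμ hν S hμS hνS hS (by omega)
  have hcard : (forks μ ν).card = 3 := by omega
  obtain ⟨x, y, z, hxy, hxz, hyz, hF⟩ := Finset.card_eq_three.1 hcard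
  have hx : x ∈ forks μ ν := by rw [hF]; simp
  have hy : y ∈ forks μ ν := by rw [hF]; simp
  have hz : z ∈ forks μ ν := by rw [hF]; simp
  have hxμ := mem_support_of_mem_forks_left hx
  have hyμ := mem_support_of_mem_forks_left hy
  have hzμ := mem_support_of_mem_forks_left hz
  -- order `y, z` along `μ` from `x`
  have hne : cdist μ x y ≠ cdist μ x z := fun h => hyz (eq_of_cdist_eq hμ hxμ hyμ hzμ h)
  rcases Nat.lt_or_gt_of_ne hne with hlt | hgt
  · have hord : y ∈ pathSet μ x z := mem_pathSet.2 ⟨hyμ, hlt⟩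
    obtain ⟨Z₀, Z₁, Z₂, h⟩ := ear_caseB_of_order hμ hν S hμS hS hcyc hF hxy hyz hxz hord
    exact ⟨x, y, z, Z₀, Z₁, Z₂, ⟨hF, hxy, hyz, hxz⟩, ⟨hord, h.1⟩, h.2⟩
  · have hord : z ∈ pathSet μ x y := mem_pathSet.2 ⟨hzμ, hgt⟩
    have hF' : forks μ ν = {x, z, y} := by
      rw [hF]; ext v; simp only [Finset.mem_insert, Finset.mem_singleton]; tauto
    obtain ⟨Z₀, Z₁, Z₂, h⟩ := ear_caseB_of_order hμ hν S hμS hS hcyc hF' hxz hyz.symm hxy hord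
    exact ⟨x, z, y, Z₀, Z₁, Z₂, ⟨hF', hxz, hyz.symm, hxy⟩, ⟨hord, h.1⟩, h.2⟩

end Summit.ValiantsHypothesis.PolyaContinued
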